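import Literature.RingTheory.MvPolynomial.BooleanLexMonic
import Mathlib.RingTheory.MvPolynomial.Groebner
import HarnessLib

/-!
# The integral lexicographic reduction operator modulo the vanishing ideal of a `0/1` point set

Topic `Literature/RingTheory/MvPolynomial`.  For a finite `V ⊆ {0,1}ⁿ` we construct the
REDUCTION OPERATOR `R_{I(V)} : ℤ[X] → ℤ[X]` of Conneryd–Ghannane–Pang (arXiv:2511.17272, §2.4:
"`R_I(p)` is the unique sum of irreducible terms `r` with `p - r ∈ I`", for the lexicographic
order) directly OVER `ℤ`: `normalForm V f` is the unique integer polynomial `r` none of whose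
exponents is the leading exponent of a monic integer polynomial vanishing on `V`
(`IsReduced V r`) and such that `f - r` vanishes on `V`.

* Existence (`exists_isReduced_sub_mem`, any finite point set over `ℤ`): Mathlib's multivariate
  division `MonomialOrder.div_set` by the set of monic members of `I(V)`.
* Uniqueness (`IsReduced.eq_of_sub_mem`, `0/1` point sets): the integrality theorem
  `degree_mem_monicExponents` of `BooleanLexMonic.lean` (CGP Lemma 5.3) — a non-zero difference
  of reduced polynomials vanishing on `V` would have a standard leading exponent.
* The calculus of §2.4 / Appendix A of the source: `normalForm` is `ℤ`-linear
  (`normalForm_add/sub/smul/sum`), kills exactly `I(V)` (`normalForm_eq_zero_iff`), depends only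
  on the class modulo `I(V)` (`normalForm_congr`), fixes reduced polynomials and `1`
  (`normalForm_of_isReduced`, `normalForm_one`), satisfies Fact A.1
  `R_J(g · R_I(f)) = R_J(g · f)` for `I ⊆ J` (`normalForm_mul_normalForm_of_subset`) and the
  uniqueness transfer behind Claim A.3 (`normalForm_eq_normalForm_of_isReduced`), and preserves
  values on `V` (`eval_normalForm`).

By construction `normalForm V (X^α) ∈ ℤ[X]`, which is the printed integrality statement
(Lemma 5.3) read over `ℤ`.

## References

* [ConnerydGhannanePang2025] J. Conneryd, Y. Ghannane, S. Pang, arXiv:2511.17272, §2.4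
  (reduction operators), Lemma 5.3, Appendix A (Fact A.1, Claim A.3). READ.
-/

noncomputable section

open MvPolynomial Finset
open scoped MonomialOrder

namespace Literature.RingTheory.MvPolynomial

variable {n : ℕ}

/-- `r` is REDUCED modulo `I(V)`: none of its exponents is a monic exponent of `V` (a sum of
irreducible = standard terms). [cite: ConnerydGhannanePang2025, §2.4] -/
def IsReduced (V : Finset (Fin n → ℤ)) (r : MvPolynomial (Fin n) ℤ) : Prop :=
  ∀ a ∈ r.support, a ∉ monicExponents V

/-- `0` is reduced. [folklore] -/
theorem isReduced_zero (V : Finset (Fin n → ℤ)) : IsReduced V 0 := by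
  intro a ha; simp at ha

/-- Reduced polynomials form an additive subgroup: sums. [folklore] -/
theorem IsReduced.add {V : Finset (Fin n → ℤ)} {r s : MvPolynomial (Fin n) ℤ} (hr : IsReduced V r)
    (hs : IsReduced V s) : IsReduced V (r + s) := by
  classical
  intro a ha
  rcases Finset.mem_union.1 (support_add ha) with h | h
  · exact hr a h
  · exact hs a h

/-- Reduced polynomials: negation. [folklore] -/
theorem IsReduced.neg {V : Finset (Fin n → ℤ)} {r : MvPolynomial (Fin n) ℤ} (hr : IsReduced V r) :
    IsReduced V (-r) := by
  intro a ha; rw [support_neg] at ha; exact hr a ha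

/-- Reduced polynomials: differences. [folklore] -/
theorem IsReduced.sub {V : Finset (Fin n → ℤ)} {r s : MvPolynomial (Fin n) ℤ} (hr : IsReduced V r)
    (hs : IsReduced V s) : IsReduced V (r - s) := by
  rw [sub_eq_add_neg]; exact hr.add hs.neg

/-- Reduced polynomials: integer multiples. [folklore] -/
theorem IsReduced.smul {V : Finset (Fin n → ℤ)} {r : MvPolynomial (Fin n) ℤ} (hr : IsReduced V r)
    (c : ℤ) : IsReduced V (c • r) :=
  fun a ha => hr a (support_smul ha)

/-- Reducedness is inherited by smaller point sets only in the other direction: if `V ⊆ W` then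
`I(W) ⊆ I(V)`, the monic exponents of `W` are monic exponents of `V`, so reduced modulo `I(V)`
implies reduced modulo `I(W)`. [folklore] -/
theorem IsReduced.of_subset {V W : Finset (Fin n → ℤ)} (h : V ⊆ W) {r : MvPolynomial (Fin n) ℤ}
    (hr : IsReduced V r) : IsReduced W r :=
  fun a ha hW => hr a ha (monicExponents_mono h hW)

/-- EXISTENCE of reduced representatives (any finite point set): divide by the monic members of
`I(V)` (Mathlib's `MonomialOrder.div_set`). [cite: ConnerydGhannanePang2025, §2.4] -/
theorem exists_isReduced_sub_mem (V : Finset (Fin n → ℤ)) (f : MvPolynomial (Fin n) ℤ) :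
    ∃ r, IsReduced V r ∧ f - r ∈ vanishing V := by
  set B : Set (MvPolynomial (Fin n) ℤ) := {b | b ∈ vanishing V ∧ MonomialOrder.lex.Monic b} with hB
  have hBu : ∀ b ∈ B, IsUnit (MonomialOrder.lex.leadingCoeff b) := fun b hb => by
    rw [hb.2.leadingCoeff_eq_one]; exact isUnit_one
  obtain ⟨g, r, hfr, -, hr⟩ := MonomialOrder.lex.div_set hBu f
  refine ⟨r, fun a ha hmon => ?_, ?_⟩
  · obtain ⟨b, hbV, hbmon, hbdeg⟩ := hmon
    exact hr a ha b ⟨hbV, hbmon⟩ (by rw [hbdeg])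
  · have hsub : f - r = Finsupp.linearCombination _ (fun b : B => (b : MvPolynomial (Fin n) ℤ)) g := by
      rw [hfr]; ring
    rw [hsub, Finsupp.linearCombination_apply]
    exact Submodule.sum_mem _ fun b _ => (vanishing V).mul_mem_left _ b.2.1

/-- UNIQUENESS of reduced representatives for `0/1` point sets (from the integrality theorem
`degree_mem_monicExponents`). [cite: ConnerydGhannanePang2025, §2.4 and Lemma 5.3] -/
theorem IsReduced.eq_of_sub_mem {V : Finset (Fin n → ℤ)} (hV : IsZeroOne V)
    {r s : MvPolynomial (Fin n) ℤ} (hr : IsReduced V r) (hs : IsReduced V s)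
    (h : r - s ∈ vanishing V) : r = s := by
  by_contra hne
  have hne' : r - s ≠ 0 := sub_ne_zero.2 hne
  exact (hr.sub hs) _ (MonomialOrder.lex.degree_mem_support hne') (degree_mem_monicExponents hV h hne')

/-- **The reduction operator** `R_{I(V)}` over `ℤ` (lexicographic order): a reduced representative
of `f` modulo `I(V)`; THE reduced representative when `V` is a `0/1` point set
(`normalForm_eq_of_isReduced`). [cite: ConnerydGhannanePang2025, §2.4] -/
def normalForm (V : Finset (Fin n → ℤ)) (f : MvPolynomial (Fin n) ℤ) : MvPolynomial (Fin n) ℤ :=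
  Classical.choose (exists_isReduced_sub_mem V f)

/-- The normal form is reduced. [cite: ConnerydGhannanePang2025, §2.4] -/
theorem isReduced_normalForm (V : Finset (Fin n → ℤ)) (f : MvPolynomial (Fin n) ℤ) :
    IsReduced V (normalForm V f) :=
  (Classical.choose_spec (exists_isReduced_sub_mem V f)).1

/-- `f - R(f) ∈ I(V)`. [cite: ConnerydGhannanePang2025, §2.4] -/
theorem sub_normalForm_mem (V : Finset (Fin n → ℤ)) (f : MvPolynomial (Fin n) ℤ) :
    f - normalForm V f ∈ vanishing V :=
  (Classical.choose_spec (exists_isReduced_sub_mem V f)).2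

/-- `R(f)` and `f` agree on `V`. [folklore] -/
theorem eval_normalForm (V : Finset (Fin n → ℤ)) (f : MvPolynomial (Fin n) ℤ) {v : Fin n → ℤ}
    (hv : v ∈ V) : eval v (normalForm V f) = eval v f := by
  have := sub_normalForm_mem V f v hv
  rw [map_sub, sub_eq_zero] at this
  exact this.symm

variable {V : Finset (Fin n → ℤ)}

/-- CHARACTERISATION: for `0/1` point sets, any reduced `r` with `f - r ∈ I(V)` is the normal
form. [cite: ConnerydGhannanePang2025, §2.4] -/
theorem normalForm_eq_of_isReduced (hV : IsZeroOne V) {f r : MvPolynomial (Fin n) ℤ}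
    (hr : IsReduced V r) (hfr : f - r ∈ vanishing V) : normalForm V f = r := by
  refine (isReduced_normalForm V f).eq_of_sub_mem hV hr ?_
  have : normalForm V f - r = (f - r) - (f - normalForm V f) := by ring
  rw [this]
  exact (vanishing V).sub_mem hfr (sub_normalForm_mem V f)

/-- Reduced polynomials are their own normal form. [folklore] -/
theorem normalForm_of_isReduced (hV : IsZeroOne V) {r : MvPolynomial (Fin n) ℤ}
    (hr : IsReduced V r) : normalForm V r = r :=
  normalForm_eq_of_isReduced hV hr (by rw [sub_self]; exact (vanishing V).zero_mem)

/-- Idempotence `R(R(f)) = R(f)`. [folklore] -/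
theorem normalForm_normalForm (hV : IsZeroOne V) (f : MvPolynomial (Fin n) ℤ) :
    normalForm V (normalForm V f) = normalForm V f :=
  normalForm_of_isReduced hV (isReduced_normalForm V f)

/-- `R` only depends on the class modulo `I(V)`. [folklore] -/
theorem normalForm_congr (hV : IsZeroOne V) {f g : MvPolynomial (Fin n) ℤ}
    (h : f - g ∈ vanishing V) : normalForm V f = normalForm V g := by
  refine normalForm_eq_of_isReduced hV (isReduced_normalForm V g) ?_
  have : f - normalForm V g = (f - g) + (g - normalForm V g) := by ring
  rw [this]
  exact (vanishing V).add_mem h (sub_normalForm_mem V g)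

/-- Members of `I(V)` reduce to `0`. [folklore] -/
theorem normalForm_of_mem (hV : IsZeroOne V) {f : MvPolynomial (Fin n) ℤ} (h : f ∈ vanishing V) :
    normalForm V f = 0 :=
  normalForm_eq_of_isReduced hV (isReduced_zero V) (by rwa [sub_zero])

/-- `R(f) = 0 ↔ f ∈ I(V)`. [cite: ConnerydGhannanePang2025, §2.4] -/
theorem normalForm_eq_zero_iff (hV : IsZeroOne V) {f : MvPolynomial (Fin n) ℤ} :
    normalForm V f = 0 ↔ f ∈ vanishing V := by
  refine ⟨fun h => ?_, normalForm_of_mem hV⟩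
  have := sub_normalForm_mem V f
  rwa [h, sub_zero] at this

/-- `R(0) = 0`. [folklore] -/
theorem normalForm_zero (hV : IsZeroOne V) : normalForm V 0 = 0 :=
  normalForm_of_mem hV (vanishing V).zero_mem

/-- Additivity of `R`. [folklore] -/
theorem normalForm_add (hV : IsZeroOne V) (f g : MvPolynomial (Fin n) ℤ) :
    normalForm V (f + g) = normalForm V f + normalForm V g := by
  refine normalForm_eq_of_isReduced hV ((isReduced_normalForm V f).add (isReduced_normalForm V g)) ?_
  have : f + g - (normalForm V f + normalForm V g) = (f - normalForm V f) + (g - normalForm V g) := by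
    ring
  rw [this]
  exact (vanishing V).add_mem (sub_normalForm_mem V f) (sub_normalForm_mem V g)

/-- `R(-f) = -R(f)`. [folklore] -/
theorem normalForm_neg (hV : IsZeroOne V) (f : MvPolynomial (Fin n) ℤ) :
    normalForm V (-f) = -normalForm V f := by
  refine normalForm_eq_of_isReduced hV (isReduced_normalForm V f).neg ?_
  have : -f - -normalForm V f = -(f - normalForm V f) := by ring
  rw [this]
  exact (vanishing V).neg_mem (sub_normalForm_mem V f)

/-- `R(f - g) = R(f) - R(g)`. [folklore] -/
theorem normalForm_sub (hV : IsZeroOne V) (f g : MvPolynomial (Fin n) ℤ) :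
    normalForm V (f - g) = normalForm V f - normalForm V g := by
  rw [sub_eq_add_neg, normalForm_add hV, normalForm_neg hV, ← sub_eq_add_neg]

/-- `ℤ`-homogeneity of `R`. [folklore] -/
theorem normalForm_smul (hV : IsZeroOne V) (c : ℤ) (f : MvPolynomial (Fin n) ℤ) :
    normalForm V (c • f) = c • normalForm V f := by
  refine normalForm_eq_of_isReduced hV ((isReduced_normalForm V f).smul c) ?_
  rw [← smul_sub]
  exact (vanishing V).smul_of_tower_mem c (sub_normalForm_mem V f)

/-- `R` commutes with finite sums. [folklore] -/
theorem normalForm_sum (hV : IsZeroOne V) {ι : Type*} (s : Finset ι)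
    (f : ι → MvPolynomial (Fin n) ℤ) :
    normalForm V (∑ i ∈ s, f i) = ∑ i ∈ s, normalForm V (f i) := by
  classical
  induction s using Finset.induction_on with
  | empty => rw [Finset.sum_empty, Finset.sum_empty, normalForm_zero hV]
  | insert i s hi ih => rw [Finset.sum_insert hi, Finset.sum_insert hi, normalForm_add hV, ih]

/-- The reduction operator as a `ℤ`-linear map. [cite: ConnerydGhannanePang2025, §2.4] -/
def normalFormₗ (hV : IsZeroOne V) : MvPolynomial (Fin n) ℤ →ₗ[ℤ] MvPolynomial (Fin n) ℤ where
  toFun := normalForm V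
  map_add' := normalForm_add hV
  map_smul' := normalForm_smul hV

/-- Unfolding `normalFormₗ`. [folklore] -/
@[simp] theorem normalFormₗ_apply (hV : IsZeroOne V) (f : MvPolynomial (Fin n) ℤ) :
    normalFormₗ hV f = normalForm V f := rfl

/-- The exponent `0` is not a monic exponent of a NON-EMPTY point set (a monic vanishing
polynomial of degree `0` would be the constant `1`). [folklore] -/
theorem zero_notMem_monicExponents (hne : V.Nonempty) : (0 : Fin n →₀ ℕ) ∉ monicExponents V := by
  rintro ⟨f, hfV, hmon, hdeg⟩
  obtain ⟨v, hv⟩ := hne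
  have hf : f = C (MonomialOrder.lex.leadingCoeff f) := MonomialOrder.eq_C_of_degree_eq_zero hdeg
  have := hfV v hv
  rw [hf, hmon.leadingCoeff_eq_one, eval_C] at this
  exact one_ne_zero this

/-- Constants are reduced modulo `I(V)` for non-empty `V`. [folklore] -/
theorem isReduced_C (hne : V.Nonempty) (c : ℤ) : IsReduced V (C c) := by
  classical
  intro a ha
  rw [← monomial_zero', support_monomial] at ha
  split_ifs at ha with hc
  · simp at ha
  · rw [Finset.mem_singleton] at ha
    subst ha
    exact zero_notMem_monicExponents hne

/-- `R(1) = 1` for a non-empty `0/1` point set. [cite: ConnerydGhannanePang2025, App. A] -/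
theorem normalForm_one (hV : IsZeroOne V) (hne : V.Nonempty) : normalForm V 1 = 1 := by
  have h := normalForm_of_isReduced hV (isReduced_C hne 1)
  rwa [C_1] at h

/-- `R(C c) = C c` for a non-empty `0/1` point set. [folklore] -/
theorem normalForm_C (hV : IsZeroOne V) (hne : V.Nonempty) (c : ℤ) : normalForm V (C c) = C c :=
  normalForm_of_isReduced hV (isReduced_C hne c)

/-- **Fact A.1 of the source** (two point sets `W ⊆ V`, so that `I(V) ⊆ I(W)`):
`R_{I(W)}(g · R_{I(V)}(f)) = R_{I(W)}(g · f)`. [cite: ConnerydGhannanePang2025, App. A, Fact A.1] -/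
theorem normalForm_mul_normalForm_of_subset {W : Finset (Fin n → ℤ)} (hW : IsZeroOne W)
    (hWV : W ⊆ V) (g f : MvPolynomial (Fin n) ℤ) :
    normalForm W (g * normalForm V f) = normalForm W (g * f) := by
  refine normalForm_congr hW ?_
  rw [← mul_sub]
  exact (vanishing W).mul_mem_left g ((vanishing W).neg_mem_iff.1
    (by rw [neg_sub]; exact vanishing_antitone hWV (sub_normalForm_mem V f)))

/-- Fact A.1 for one point set: `R(g · R(f)) = R(g · f)`.
[cite: ConnerydGhannanePang2025, App. A, Fact A.1] -/
theorem normalForm_mul_normalForm (hV : IsZeroOne V) (g f : MvPolynomial (Fin n) ℤ) :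
    normalForm V (g * normalForm V f) = normalForm V (g * f) :=
  normalForm_mul_normalForm_of_subset hV subset_rfl g f

/-- **The uniqueness transfer behind Claim A.3 of the source**: for `W ⊆ V` (`I(V) ⊆ I(W)`), if
`R_{I(V)}(f)` happens to be reduced modulo the larger ideal `I(W)` then it IS `R_{I(W)}(f)`.
[cite: ConnerydGhannanePang2025, App. A, Claim A.3] -/
theorem normalForm_eq_normalForm_of_isReduced {W : Finset (Fin n → ℤ)} (hW : IsZeroOne W)
    (hWV : W ⊆ V) {f : MvPolynomial (Fin n) ℤ} (h : IsReduced W (normalForm V f)) :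
    normalForm W f = normalForm V f :=
  normalForm_eq_of_isReduced hW h (vanishing_antitone hWV (sub_normalForm_mem V f))

/-- The values of `R(f)` at the points of `V` are those of `f`; in particular the linear
functional `eval_y ∘ R` used in the proof of Lemma 4.4 of the source is computed on `V` by
evaluating `f`. [cite: ConnerydGhannanePang2025, proof of Lemma 4.4] -/
theorem eval_normalForm_eq (f : MvPolynomial (Fin n) ℤ) {v : Fin n → ℤ} (hv : v ∈ V) :
    eval v (normalForm V f) = eval v f :=
  eval_normalForm V f hv

end Literature.RingTheory.MvPolynomial
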